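import Summits.CriticalPhenomena.PercolationContinuityZ3.Theorems.PercNearOneGluingNoHeavyPcintThirdMem
import Summits.CriticalPhenomena.PercolationContinuityZ3.Theorems.PercNearOneGluingNoHeavyPcintChainMemStep
import HarnessLib

/-!
# PCINT lane, reduction B3t on the memory-`τ` DANGEROUS-SET automaton — the step factors, off the path and on the path

Cell `prim-pcint` (PAPER-2 track (iii): certified intervals for `p_c(ℤ^d)`), seat `prim-pcint-2` (gen 4); support file
(`--supports stmt-CriticalPhenomena-4575`).  Does NOT build on p205010.  Memo: `run/shared/lean/prim/pcint/REDUCTIONS.md` §B3t.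

The unit factor `s^{cdet-ctu} t^{ctu} κ̄^{[bcorner]}` of a B3t step (`…ThirdMem`) is the product of site factors
`siteF = s^{uA-uAt} t^{uAt}` over the det-paying sites times the corner factor; we split it as `offF · onF` according to
whether the (absolute) site lies on the path (`unitFactor_eq_offF_mul_onF`).  PROVED here: (1) the full B3t weight is a
product of time factors `tgapFactor` (`thirdBondWeight_eq_prod`); (2) OFF THE PATH the time factor is dominated,
`tgapFactor (t+1) ≤ offF t` (`tgapFactor_le_offF`, via the unit comparisons `one_add_bcbonus_le_uF`,
`one_le_uFt_of_mem_ctSet`, `one_le_uF_cornerSite`); (3) ON THE PATH the factor `onF t` is at least the product of the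
charges `chargeF` over the on-path events of the fibre `t` of `onEventsR` (`prod_chargeF_le_onF`) — these charges are
booked on chords in `…ThirdMemBook`.
-/

noncomputable section

namespace Summit.CriticalPhenomena.PercolationContinuityZ3.Theorems.Pcint

open Finset Literature.Probability.Percolation Literature.Probability.LatticeModels ChainBond

variable {d : ℕ} (a₀ : Fin d × Bool) {τ kc n : ℕ} {γ : Fin n → Fin d × Bool}

/-! ### The time factors of the B3t weight -/

/-- The full-information two-unit factor of the incidence of `w` at time `T`. [folklore] -/
def tsiteF (s tv : ℝ) (kc : ℕ) (γ : Fin n → Fin d × Bool) (w : Site d) (T : ℕ) : ℝ :=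
  s ^ (uF kc γ w T - uFt kc γ w T) * tv ^ uFt kc γ w T

open Classical in
/-- The full B3t factor of a word at time `T`: site factors over the off-path sites times the corner coin mean. [folklore] -/
def tgapFactor (s tv : ℝ) (kc : ℕ) (γ : Fin n → Fin d × Bool) (T : ℕ) : ℝ :=
  (∏ w ∈ offSites γ, tsiteF s tv kc γ w T) * (if 2 ≤ T ∧ IsCorner γ (T - 2) then (1 + s ^ 2) / 2 else 1)

section Factors

variable {s tv : ℝ} (hs0 : 0 ≤ s) (hs1 : s ≤ 1) (ht0 : 0 ≤ tv) (hts : tv ≤ s)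
include hs0 hs1 ht0 hts

omit hs1 hts in
/-- Site factors are nonnegative. [folklore] -/
theorem tsiteF_nonneg (kc : ℕ) (γ : Fin n → Fin d × Bool) (w : Site d) (T : ℕ) : 0 ≤ tsiteF s tv kc γ w T := by
  unfold tsiteF; positivity

/-- Site factors are at most one. [folklore] -/
theorem tsiteF_le_one (kc : ℕ) (γ : Fin n → Fin d × Bool) (w : Site d) (T : ℕ) : tsiteF s tv kc γ w T ≤ 1 := by
  unfold tsiteF
  exact mul_le_one₀ (pow_le_one₀ hs0 hs1) (pow_nonneg ht0 _) (pow_le_one₀ ht0 (hts.trans hs1))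

omit hs1 hts in
/-- Time factors are nonnegative. [folklore] -/
theorem tgapFactor_nonneg (kc : ℕ) (γ : Fin n → Fin d × Bool) (T : ℕ) : 0 ≤ tgapFactor s tv kc γ T := by
  classical
  unfold tgapFactor
  have := prod_nonneg fun w (_ : w ∈ offSites γ) => tsiteF_nonneg hs0 ht0 kc γ w T
  split_ifs <;> positivity

/-- Dropping sites from the product of site factors increases it. [folklore] -/
theorem prod_tsiteF_le_of_subset (kc : ℕ) (γ : Fin n → Fin d × Bool) (T : ℕ) {J : Finset (Site d)}
    (hJ : J ⊆ offSites γ) : ∏ w ∈ offSites γ, tsiteF s tv kc γ w T ≤ ∏ w ∈ J, tsiteF s tv kc γ w T := by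
  classical
  rw [← prod_sdiff hJ]
  exact mul_le_of_le_one_left (prod_nonneg fun w _ => tsiteF_nonneg hs0 ht0 kc γ w T)
    (prod_le_one (fun w _ => tsiteF_nonneg hs0 ht0 kc γ w T) fun w _ => tsiteF_le_one hs0 hs1 ht0 hts kc γ w T)

end Factors

/-- No unit at time `0`. [folklore] -/
theorem uF_zero (kc : ℕ) (γ : Fin n → Fin d × Bool) (w : Site d) : uF kc γ w 0 = 0 := by
  classical
  unfold uF
  have key : ∀ k, paysAt kc γ w k → incAt γ w k ≠ 0 := by
    intro k hp h0
    have := incAt_strictMono (by have := hp.1; omega : 0 < k) hp.2.1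
    omega
  rw [Nat.add_eq_zero_iff, card_eq_zero, card_eq_zero, filter_eq_empty_iff, filter_eq_empty_iff]
  exact ⟨fun k hk => key k (mem_paySet.1 hk), fun k hk => key k (mem_bonusSet.1 hk).1⟩

/-- The time-`0` factor is one. [folklore] -/
theorem tgapFactor_zero (s tv : ℝ) (kc : ℕ) (γ : Fin n → Fin d × Bool) : tgapFactor s tv kc γ 0 = 1 := by
  classical
  unfold tgapFactor
  rw [if_neg (by omega), mul_one]
  refine prod_eq_one fun w _ => ?_
  unfold tsiteF
  have h0 := uF_zero kc γ w
  have h1 : uFt kc γ w 0 = 0 := by have := uFt_le_uF kc γ w 0; omega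
  rw [h0, h1, Nat.sub_zero, pow_zero, pow_zero, mul_one]

/-- **The B3t weight as a product of time factors.** [folklore] -/
theorem thirdBondWeight_eq_prod (p s tv : ℝ) (kc : ℕ) (γ : Fin n → Fin d × Bool) :
    thirdBondWeight p s tv kc γ = p ^ n * (1 - p) ^ (chordEdges γ).card * ∏ T ∈ range (n + 1), tgapFactor s tv kc γ T := by
  classical
  unfold thirdBondWeight tgapFactor
  rw [prod_mul_distrib, prod_ite, prod_const_one, mul_one, prod_const, card_filter_corner]
  have hsite : ∏ T ∈ range (n + 1), ∏ w ∈ offSites γ, tsiteF s tv kc γ w T = s ^ sTotal kc γ * tv ^ tTotal kc γ := by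
    have h1 : ∀ T, ∏ w ∈ offSites γ, tsiteF s tv kc γ w T =
        s ^ (dunitsAt kc γ T - tunitsAt kc γ T) * tv ^ tunitsAt kc γ T := by
      intro T
      unfold tsiteF
      rw [prod_mul_distrib, prod_pow_eq_pow_sum, prod_pow_eq_pow_sum, dunitsAt, tunitsAt,
        sum_tsub_distrib _ (fun w _ => uFt_le_uF kc γ w T)]
    rw [prod_congr rfl (fun T _ => h1 T), prod_mul_distrib, prod_pow_eq_pow_sum, prod_pow_eq_pow_sum, ← sTotal_eq_sum,
      ← tTotal_eq_sum]
  rw [hsite]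
  ring

/-! ### The automaton's site factors and the off/on split -/

section Step

open Classical

/-- The automaton's `t`-unit indicator of a det-paying site. [folklore] -/
def uAt (kc : ℕ) (S : MState d) (a : Fin d × Bool) (w' : Site d) : ℕ := if w' ∈ ctSet kc S a then 1 else 0

/-- The automaton's two-unit factor of a det-paying site: `s^{uA - uAt} t^{uAt}`. [folklore] -/
def siteF (s tv : ℝ) (τ kc : ℕ) (S : MState d) (a : Fin d × Bool) (w' : Site d) : ℝ :=
  s ^ (uA τ kc S w' - uAt kc S a w') * tv ^ uAt kc S a w'

/-- `uAt ≤ 1 ≤ uA`. [folklore] -/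
theorem uAt_le_uA (τ kc : ℕ) (S : MState d) (a : Fin d × Bool) (w' : Site d) : uAt kc S a w' ≤ uA τ kc S w' := by
  unfold uAt uA; split_ifs <;> omega

/-- **The unit factor is the product of the site factors.** [folklore] -/
theorem unitFactor_eq_prod (s tv : ℝ) (τ kc : ℕ) (S : MState d) (a : Fin d × Bool) :
    s ^ (cdet τ kc S a - ctu kc S a) * tv ^ ctu kc S a = ∏ w' ∈ cdetSet kc S a, siteF s tv τ kc S a w' := by
  unfold siteF
  rw [prod_mul_distrib, prod_pow_eq_pow_sum, prod_pow_eq_pow_sum]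
  have hT : ∑ w' ∈ cdetSet kc S a, uAt kc S a w' = ctu kc S a := by
    unfold uAt ctu
    rw [sum_boole, Nat.cast_id]
    congr 1
    ext w
    simp only [mem_filter, and_iff_right_iff_imp]
    exact fun h => ctSet_subset kc S a h
  have hS : ∑ w' ∈ cdetSet kc S a, (uA τ kc S w' - uAt kc S a w') = cdet τ kc S a - ctu kc S a := by
    rw [sum_tsub_distrib _ fun w' _ => uAt_le_uA τ kc S a w', ← cdet_eq_sum, hT]
  rw [hT, hS]

variable {s tv κb : ℝ}

/-- The OFF-PATH part of the step factor. [folklore] -/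
def offF (s tv κb : ℝ) (τ kc : ℕ) (γ : Fin n → Fin d × Bool) (t : ℕ) : ℝ :=
  if ht : t < n then
    (∏ w' ∈ (cdetSet kc (danger τ (pre a₀ γ t)) (γ ⟨t, ht⟩)).filter fun w' => w' + wordPos γ t ∉ pathSites γ,
        siteF s tv τ kc (danger τ (pre a₀ γ t)) (γ ⟨t, ht⟩) w') *
      (if bcorner (danger τ (pre a₀ γ t)) (γ ⟨t, ht⟩) = true ∧ cornerSite γ (t - 1) ∉ pathSites γ then κb else 1)
  else 1

/-- The ON-PATH part of the step factor. [folklore] -/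
def onF (s tv κb : ℝ) (τ kc : ℕ) (γ : Fin n → Fin d × Bool) (t : ℕ) : ℝ :=
  if ht : t < n then
    (∏ w' ∈ (cdetSet kc (danger τ (pre a₀ γ t)) (γ ⟨t, ht⟩)).filter fun w' => w' + wordPos γ t ∈ pathSites γ,
        siteF s tv τ kc (danger τ (pre a₀ γ t)) (γ ⟨t, ht⟩) w') *
      (if bcorner (danger τ (pre a₀ γ t)) (γ ⟨t, ht⟩) = true ∧ cornerSite γ (t - 1) ∈ pathSites γ then κb else 1)
  else 1

/-- **The step's unit factor splits as `offF · onF`.** [folklore] -/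
theorem unitFactor_eq_offF_mul_onF {t : ℕ} (ht : t < n) :
    s ^ (cdet τ kc (danger τ (pre a₀ γ t)) (γ ⟨t, ht⟩) - ctu kc (danger τ (pre a₀ γ t)) (γ ⟨t, ht⟩)) *
        tv ^ ctu kc (danger τ (pre a₀ γ t)) (γ ⟨t, ht⟩) *
        (if bcorner (danger τ (pre a₀ γ t)) (γ ⟨t, ht⟩) then κb else 1) =
      offF a₀ s tv κb τ kc γ t * onF a₀ s tv κb τ kc γ t := by
  rw [unitFactor_eq_prod, offF, onF, dif_pos ht, dif_pos ht]
  set D := cdetSet kc (danger τ (pre a₀ γ t)) (γ ⟨t, ht⟩)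
  rw [← prod_filter_mul_prod_filter_not D (fun w' => w' + wordPos γ t ∈ pathSites γ)]
  by_cases hc : bcorner (danger τ (pre a₀ γ t)) (γ ⟨t, ht⟩) = true
  · by_cases hon : cornerSite γ (t - 1) ∈ pathSites γ
    · rw [if_pos hc, if_neg (fun h => h.2 hon), if_pos ⟨hc, hon⟩]; ring
    · rw [if_pos hc, if_pos ⟨hc, hon⟩, if_neg (fun h => hon h.2)]; ring
  · rw [if_neg hc, if_neg (fun h => hc h.1), if_neg (fun h => hc h.1)]; ring

/-- `offF` is nonnegative. [folklore] -/
theorem offF_nonneg (hs0 : 0 ≤ s) (ht0 : 0 ≤ tv) (hκb : 0 ≤ κb) (t : ℕ) : 0 ≤ offF a₀ s tv κb τ kc γ t := by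
  unfold offF siteF; split_ifs <;> positivity

/-- `onF` is nonnegative. [folklore] -/
theorem onF_nonneg (hs0 : 0 ≤ s) (ht0 : 0 ≤ tv) (hκb : 0 ≤ κb) (t : ℕ) : 0 ≤ onF a₀ s tv κb τ kc γ t := by
  unfold onF siteF; split_ifs <;> positivity

/-! ### Off the path: the time factor is dominated -/

/-- **A det-paying site's full-information factor is at most its automaton factor.** [folklore] -/
theorem tsiteF_le_siteF (hτ : kc + 4 ≤ τ) (hkc : 2 ≤ kc) {t : ℕ} (ht : t < n) (hs1 : s ≤ 1) (ht0 : 0 ≤ tv) (hts : tv ≤ s)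
    {w' : Site d} (hw' : w' ∈ cdetSet kc (danger τ (pre a₀ γ t)) (γ ⟨t, ht⟩)) :
    tsiteF s tv kc γ (w' + wordPos γ t) (t + 1) ≤ siteF s tv τ kc (danger τ (pre a₀ γ t)) (γ ⟨t, ht⟩) w' := by
  unfold tsiteF siteF
  have hU := one_add_bcbonus_le_uF a₀ hτ ht hw'
  have hUA : uA τ kc (danger τ (pre a₀ γ t)) w' ≤ uF kc γ (w' + wordPos γ t) (t + 1) := by unfold uA; exact hU
  have hTA : uAt kc (danger τ (pre a₀ γ t)) (γ ⟨t, ht⟩) w' ≤ uFt kc γ (w' + wordPos γ t) (t + 1) := by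
    unfold uAt
    split_ifs with h
    · exact one_le_uFt_of_mem_ctSet a₀ hτ hkc ht h
    · exact Nat.zero_le _
  have h1 := uFt_le_uF kc γ (w' + wordPos γ t) (t + 1)
  have h2 := uAt_le_uA τ kc (danger τ (pre a₀ γ t)) (γ ⟨t, ht⟩) w'
  exact spow_tpow_le hs1 ht0 hts hTA (by omega)

/-- **Off-path domination for kind `chordthird`**: `tgapFactor (t+1) ≤ offF t` (`0 < t ≤ s ≤ 1`, `(1+s²)/2 ≤ κ̄`, `kc ≥ 2`,
`kc + 4 ≤ τ`). [folklore] -/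
theorem tgapFactor_le_offF (hτ : kc + 4 ≤ τ) (hkc : 2 ≤ kc) {t : ℕ} (ht : t < n) (hs0 : 0 ≤ s) (hs1 : s ≤ 1)
    (ht0 : 0 ≤ tv) (hts : tv ≤ s) (hκb : (1 + s ^ 2) / 2 ≤ κb) :
    tgapFactor s tv kc γ (t + 1) ≤ offF a₀ s tv κb τ kc γ t := by
  set S := danger τ (pre a₀ γ t) with hS
  set a := γ ⟨t, ht⟩ with ha
  set Doff := (cdetSet kc S a).filter fun w' => w' + wordPos γ t ∉ pathSites γ with hDoff
  set I := Doff.image fun w' => w' + wordPos γ t with hI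
  have hκ0 : 0 ≤ κb := by nlinarith
  have hsκ : s ≤ κb := by nlinarith
  have hcoin : (1 + s ^ 2) / 2 ≤ κb := hκb
  -- the image lies in the off-path sites
  have hIsub : I ⊆ offSites γ := by
    intro w hw
    obtain ⟨w', hw', rfl⟩ := mem_image.1 hw
    obtain ⟨hD, hoff⟩ := mem_filter.1 hw'
    have hn := (mem_filter.1 hD).1
    rw [mem_nbrSites] at hn
    refine mem_offSites.2 ⟨hoff, t + 1, by omega, ?_⟩
    rw [← adj_sub_wordPos_iff γ t, ← stepVec_eq_sub ht, add_sub_cancel_right]; exact hn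
  -- site factors over the image are dominated by the automaton's
  have hprodI : ∏ w ∈ I, tsiteF s tv kc γ w (t + 1) ≤ ∏ w' ∈ Doff, siteF s tv τ kc S a w' := by
    rw [hI, prod_image fun x _ y _ h => add_right_cancel h]
    exact prod_le_prod (fun w' _ => tsiteF_nonneg hs0 ht0 kc γ _ _) fun w' hw' =>
      tsiteF_le_siteF a₀ hτ hkc ht hs1 ht0 hts (mem_filter.1 hw').1
  have hprodI0 : 0 ≤ ∏ w ∈ I, tsiteF s tv kc γ w (t + 1) := prod_nonneg fun w _ => tsiteF_nonneg hs0 ht0 kc γ _ _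
  have hDoff0 : 0 ≤ ∏ w' ∈ Doff, siteF s tv τ kc S a w' := by unfold siteF; exact prod_nonneg fun _ _ => by positivity
  rw [offF, dif_pos ht, tgapFactor]
  set cornerF : ℝ := (if 2 ≤ t + 1 ∧ IsCorner γ (t + 1 - 2) then (1 + s ^ 2) / 2 else 1) with hcornerF
  have hcf0 : 0 ≤ cornerF := by rw [hcornerF]; split_ifs <;> positivity
  have hcf1 : cornerF ≤ 1 := by rw [hcornerF]; split_ifs <;> nlinarith
  by_cases hc : bcorner S a = true
  · obtain ⟨ht1, -⟩ := bcorner_spec a₀ ht hc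
    by_cases hon : cornerSite γ (t - 1) ∈ pathSites γ
    · -- corner site on the path: no corner factor off the path, and not a genuine corner
      rw [if_neg (fun h => h.2 hon)]
      have hnc : ¬ (2 ≤ t + 1 ∧ IsCorner γ (t + 1 - 2)) := by
        rintro ⟨-, hcor⟩
        rw [show t + 1 - 2 = t - 1 by omega] at hcor
        obtain ⟨_, _, hoffc, _⟩ := hcor
        exact hoffc hon
      rw [hcornerF, if_neg hnc, mul_one, mul_one]
      exact (prod_tsiteF_le_of_subset hs0 hs1 ht0 hts kc γ _ hIsub).trans hprodI
    · rw [if_pos ⟨hc, hon⟩]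
      by_cases hgc : IsCorner γ (t - 1)
      · -- a genuine corner: the coin
        have hcf : cornerF ≤ κb := by
          rw [hcornerF, if_pos ⟨by omega, by rw [show t + 1 - 2 = t - 1 by omega]; exact hgc⟩]; exact hcoin
        exact mul_le_mul ((prod_tsiteF_le_of_subset hs0 hs1 ht0 hts kc γ _ hIsub).trans hprodI) hcf hcf0 hDoff0
      · -- not a genuine corner: the corner site carries a full-information unit, its factor is `≤ s ≤ κ̄`
        obtain ⟨huF, hnotD⟩ := one_le_uF_cornerSite a₀ hkc ht hc hon hgc
        have hCnot : cornerSite γ (t - 1) ∉ I := by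
          intro hC
          obtain ⟨w', hw', hwC⟩ := mem_image.1 hC
          apply hnotD
          rw [show cornerSite γ (t - 1) - wordPos γ t = w' by rw [← hwC, add_sub_cancel_right]]
          exact (mem_filter.1 hw').1
        have hCoffS : cornerSite γ (t - 1) ∈ offSites γ := by
          obtain ⟨_, -, -, hC1, -⟩ := bcorner_spec a₀ ht hc
          exact mem_offSites.2 ⟨hon, t + 1, by omega, hC1⟩
        have hCfac : tsiteF s tv kc γ (cornerSite γ (t - 1)) (t + 1) ≤ s := by
          unfold tsiteF
          have h1 := uFt_le_uF kc γ (cornerSite γ (t - 1)) (t + 1)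
          have := spow_tpow_le (a := 1) (b := 0) hs1 ht0 hts (Nat.zero_le (uFt kc γ (cornerSite γ (t - 1)) (t + 1)))
            (by omega : 1 + 0 ≤ uF kc γ (cornerSite γ (t - 1)) (t + 1) - uFt kc γ (cornerSite γ (t - 1)) (t + 1) +
              uFt kc γ (cornerSite γ (t - 1)) (t + 1))
          simpa using this
        have hnc : ¬ (2 ≤ t + 1 ∧ IsCorner γ (t + 1 - 2)) := by
          rintro ⟨-, hcor⟩
          rw [show t + 1 - 2 = t - 1 by omega] at hcor
          exact hgc hcor
        rw [hcornerF, if_neg hnc, mul_one]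
        calc ∏ w ∈ offSites γ, tsiteF s tv kc γ w (t + 1)
            ≤ ∏ w ∈ insert (cornerSite γ (t - 1)) I, tsiteF s tv kc γ w (t + 1) :=
              prod_tsiteF_le_of_subset hs0 hs1 ht0 hts kc γ _ (insert_subset hCoffS hIsub)
          _ = tsiteF s tv kc γ (cornerSite γ (t - 1)) (t + 1) * ∏ w ∈ I, tsiteF s tv kc γ w (t + 1) := prod_insert hCnot
          _ ≤ s * ∏ w' ∈ Doff, siteF s tv τ kc S a w' := mul_le_mul hCfac hprodI hprodI0 hs0
          _ ≤ κb * ∏ w' ∈ Doff, siteF s tv τ kc S a w' := mul_le_mul_of_nonneg_right hsκ hDoff0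
          _ = _ := mul_comm _ _
  · rw [if_neg (fun h => hc h.1), mul_one]
    calc (∏ w ∈ offSites γ, tsiteF s tv kc γ w (t + 1)) * cornerF
        ≤ (∏ w' ∈ Doff, siteF s tv τ kc S a w') * 1 :=
          mul_le_mul ((prod_tsiteF_le_of_subset hs0 hs1 ht0 hts kc γ _ hIsub).trans hprodI) hcf1 hcf0 hDoff0
      _ = _ := mul_one _

end Step

end Summit.CriticalPhenomena.PercolationContinuityZ3.Theorems.Pcint
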